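import Literature.Analysis.FluidPDE.FiniteFourierModeEulerChain
import Literature.Analysis.FluidPDE.FiniteFourierModeEulerFace
import Literature.Analysis.FluidPDE.FiniteFourierModeEulerPlanarCoord
import Literature.Analysis.FluidPDE.FiniteFourierModeEulerPolygonC

/-!
# Kishimoto–Yoneda §3 (planar case): the boundary polygon of a planar symmetric set, I

Support file for `FiniteFourierModeEuler` (N. Kishimoto, T. Yoneda, J. Math. Fluid Mech. 24
(2022) 74 = arXiv:2110.08039), §3. For a finite symmetric set `T` spanning the plane `e^⊥`
("`S^{conv}_∥` is a (nondegenerate) symmetric polygon on `P`") we list the vertices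
`V₀, V₁, …, V_m` (cyclically, `V_{m+1} = V₀`) of the convex polygon `conv T` in positive order and
set up the edge functionals `f_j` ("the linear functional on `P` such that `f ≡ 1` on `E`") and the
Minkowski functional `N = max_j f_j` on sectors: `N ≡ f_j` on `{s V_j + t V_{j+1} : s, t ≥ 0}`.

The vertices are obtained from `FiniteFourierModeEulerPolygonB/C` by LIFTING `T` to the affine
plane `{x : e·x = 1}` (`n ↦ n + c e`, `c = 1/|e|²`): the lifted set is a two-dimensional face of
its own convex hull at the lifted farthest point, so `FaceCfg` applies verbatim.

## References

* [KishimotoYoneda2022] N. Kishimoto, T. Yoneda, J. Math. Fluid Mech. 24 (2022) 74 =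
  arXiv:2110.08039, §3 proof of Prop. 3.1 (`S^{conv}_∥`, its sides `E`, the functionals `f`, `N`).
* [folklore] vertices and edges of a planar convex polygon.
-/

noncomputable section

open Matrix Finset Complex

namespace Literature.Analysis.FluidPDE

namespace KY

open scoped Classical

/-- A finite symmetric subset of the plane `e^⊥`, not containing `0`, spanning the plane.
[cite: KishimotoYoneda2022, §3 Prop. 3.1 ("`S^{conv}` … is a (nondegenerate) symmetric polygon on a plane `P`")] -/
structure PolyCfg (T : Finset (Fin 3 → ℝ)) (e : Fin 3 → ℝ) : Prop where
  he : e ≠ 0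
  zero_notMem : (0 : Fin 3 → ℝ) ∉ T
  symm : ∀ s ∈ T, -s ∈ T
  plane : ∀ s ∈ T, e ⬝ᵥ s = 0
  span : ∃ a ∈ T, ∃ b ∈ T, pc e a b ≠ 0

namespace PolyCfg

variable {T : Finset (Fin 3 → ℝ)} {e : Fin 3 → ℝ} (P : PolyCfg T e)
include P

/-- Polygon bookkeeping: `nonempty`. [folklore] -/
theorem nonempty : T.Nonempty := by obtain ⟨a, ha, -⟩ := P.span; exact ⟨a, ha⟩

/-! ### The lift to the affine plane `{e·x = 1}` -/

omit P in
/-- The lifting height `c = 1/|e|²`. [folklore] -/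
def hc (e : Fin 3 → ℝ) : ℝ := 1 / (e ⬝ᵥ e)

/-- Polygon bookkeeping: `hc_pos`. [folklore] -/
theorem hc_pos : 0 < hc e := by
  unfold hc
  have : 0 < e ⬝ᵥ e := lt_of_le_of_ne
    (by rw [real_dot_eq]; nlinarith [sq_nonneg (e 0), sq_nonneg (e 1), sq_nonneg (e 2)])
    (Ne.symm (real_dot_self_ne_zero P.he))
  positivity

/-- Polygon bookkeeping: `hc_mul`. [folklore] -/
theorem hc_mul : hc e * (e ⬝ᵥ e) = 1 := by
  unfold hc; rw [one_div, inv_mul_cancel₀ (real_dot_self_ne_zero P.he)]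

omit P in
/-- The lifted set `T + c e`. [folklore] -/
def lift (T : Finset (Fin 3 → ℝ)) (e : Fin 3 → ℝ) : Finset (Fin 3 → ℝ) := T.image fun n => n + hc e • e

omit P in
/-- Polygon bookkeeping: `mem_lift`. [folklore] -/
theorem mem_lift {x : Fin 3 → ℝ} : x ∈ lift T e ↔ x - hc e • e ∈ T := by
  unfold lift
  rw [Finset.mem_image]
  constructor
  · rintro ⟨n, hn, rfl⟩; simpa using hn
  · intro h; exact ⟨x - hc e • e, h, by simp⟩

omit P in
/-- Polygon bookkeeping: `add_mem_lift`. [folklore] -/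
theorem add_mem_lift {n : Fin 3 → ℝ} : n + hc e • e ∈ lift T e ↔ n ∈ T := by
  rw [mem_lift, add_sub_cancel_right]

/-- Lifted points are at level `1`. [folklore] -/
theorem lift_level {x : Fin 3 → ℝ} (hx : x ∈ lift T e) : x ⬝ᵥ e = 1 := by
  rw [mem_lift] at hx
  have h := P.plane _ hx
  rw [dotProduct_sub, dotProduct_smul, smul_eq_mul, sub_eq_zero] at h
  rw [dotProduct_comm, h, P.hc_mul]

/-- **The lifted triple product is the planar cross pairing**:
`[x + ce, y + ce, s + ce] = c τ(y - x, s - x)` for planar `x, y, s`. [folklore] -/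
theorem lift_triple {x y s : Fin 3 → ℝ} (hx : e ⬝ᵥ x = 0) (hy : e ⬝ᵥ y = 0) (hs : e ⬝ᵥ s = 0) :
    (x + hc e • e) ⬝ᵥ ((y + hc e • e) ⨯₃ (s + hc e • e)) = hc e * pc e (y - x) (s - x) := by
  -- `x · (y × s) = 0` for three planar vectors
  have h0 : x ⬝ᵥ (y ⨯₃ s) = 0 := by
    rw [cross_planar P.he hy hs, dotProduct_smul, smul_eq_mul, dotProduct_comm x e, hx, mul_zero]
  have e1 : x ⬝ᵥ (y ⨯₃ e) = e ⬝ᵥ (x ⨯₃ y) := by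
    simp [cross_apply, dotProduct, Fin.sum_univ_three]; ring
  have e2 : x ⬝ᵥ (e ⨯₃ s) = -(e ⬝ᵥ (x ⨯₃ s)) := by
    simp [cross_apply, dotProduct, Fin.sum_univ_three]; ring
  have e3 : e ⬝ᵥ (y ⨯₃ e) = 0 := by simp [cross_apply, dotProduct, Fin.sum_univ_three]; ring
  have e4 : e ⬝ᵥ (e ⨯₃ s) = 0 := dot_self_cross e s
  have e5 : e ⬝ᵥ (e ⨯₃ e) = 0 := dot_self_cross e e
  have e6 : x ⬝ᵥ (e ⨯₃ e) = 0 := by rw [cross_self, dotProduct_zero]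
  simp only [map_add, map_smul, LinearMap.add_apply, LinearMap.smul_apply, dotProduct_add,
    dotProduct_smul, add_dotProduct, smul_dotProduct, smul_eq_mul, h0, e1, e2, e3, e4, e5, e6,
    mul_zero, add_zero, zero_add]
  have key : e ⬝ᵥ ((y - x) ⨯₃ (s - x)) = e ⬝ᵥ (y ⨯₃ s) + -(e ⬝ᵥ (x ⨯₃ s)) + e ⬝ᵥ (x ⨯₃ y) := by
    simp [cross_apply, dotProduct, Fin.sum_univ_three]; ring
  unfold pc; rw [key]; ring

/-- A farthest point of `T`. [folklore] -/
def far (P : PolyCfg T e) : Fin 3 → ℝ := (T.exists_max_image (fun s => s ⬝ᵥ s) P.nonempty).choose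

/-- Polygon bookkeeping: `far_mem`. [folklore] -/
theorem far_mem : P.far ∈ T := (T.exists_max_image (fun s => s ⬝ᵥ s) P.nonempty).choose_spec.1

/-- Polygon bookkeeping: `far_max`. [folklore] -/
theorem far_max : ∀ s ∈ T, s ⬝ᵥ s ≤ P.far ⬝ᵥ P.far :=
  (T.exists_max_image (fun s => s ⬝ᵥ s) P.nonempty).choose_spec.2

/-- The lifted farthest point. [folklore] -/
def p₀ (P : PolyCfg T e) : Fin 3 → ℝ := P.far + hc e • e

/-- Some point of `T` is not parallel to the farthest point. [folklore] -/
theorem exists_pc_far_ne_zero : ∃ s ∈ T, pc e P.far s ≠ 0 := by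
  by_contra hno
  push Not at hno
  obtain ⟨a, ha, b, hb, hab⟩ := P.span
  have hf0 : P.far ≠ 0 := fun h => P.zero_notMem (h ▸ P.far_mem)
  -- all points are multiples of `far`
  have hpar : ∀ s ∈ T, ∃ r : ℝ, s = r • P.far := by
    intro s hs
    have h := hno s hs
    have hcr : P.far ⨯₃ s = 0 := by
      rw [cross_planar P.he (P.plane _ P.far_mem) (P.plane s hs), h, zero_div, zero_smul]
    exact ⟨_, eq_smul_of_cross_eq_zero hf0 (by rw [← cross_anticomm, hcr, neg_zero])⟩
  obtain ⟨r, hr⟩ := hpar a ha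
  obtain ⟨r', hr'⟩ := hpar b hb
  apply hab
  rw [hr, hr', pc_smul_left, pc_smul_right, pc_self, mul_zero, mul_zero]

/-- **The lifted set is a two-dimensional face at the lifted farthest point.** [folklore] -/
theorem faceCfg : FaceCfg (lift T e) e P.p₀ 1 where
  hM := one_pos
  hmax := fun s hs => (P.lift_level hs).le
  hp₀ := by unfold p₀; rw [add_mem_lift]; exact P.far_mem
  hpM := P.lift_level (by unfold p₀; rw [add_mem_lift]; exact P.far_mem)
  hfar := by
    intro s hs hne
    rw [mem_lift] at hs
    have hfar := exposed_of_dot_self_eq_max P.far_max (s - hc e • e) hs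
      (by intro h; apply hne; unfold p₀; rw [← h]; simp)
    have hs' : s = (s - hc e • e) + hc e • e := by simp
    unfold p₀
    rw [hs']
    set n := s - hc e • e
    have hen : e ⬝ᵥ n = 0 := P.plane n hs
    have hef : e ⬝ᵥ P.far = 0 := P.plane _ P.far_mem
    simp only [dotProduct_add, add_dotProduct, dotProduct_smul, smul_dotProduct, smul_eq_mul,
      dotProduct_comm P.far e, hen, hef, mul_zero, add_zero, zero_add]
    linarith
  h2 := by
    obtain ⟨s, hs, hfs⟩ := P.exists_pc_far_ne_zero
    refine ⟨-P.far + hc e • e, add_mem_lift.2 (P.symm _ P.far_mem), s + hc e • e, add_mem_lift.2 hs,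
      P.lift_level (add_mem_lift.2 (P.symm _ P.far_mem)), P.lift_level (add_mem_lift.2 hs), ?_⟩
    unfold p₀
    have hef : e ⬝ᵥ P.far = 0 := P.plane _ P.far_mem
    rw [P.lift_triple hef (by rw [dotProduct_neg, hef, neg_zero]) (P.plane s hs)]
    rw [show -P.far - P.far = (-2 : ℝ) • P.far by ext i; simp; ring,
      pc_smul_left, pc_sub_right, pc_self, sub_zero]
    exact mul_ne_zero P.hc_pos.ne' (mul_ne_zero (by norm_num) hfs)

/-! ### The vertices -/

/-- The number of vertices other than `V₀`. [folklore] -/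
def m (P : PolyCfg T e) : ℕ := FaceCfg.nverts (lift T e) e P.p₀ 1

/-- **The vertices `V₀ = far, V₁, …, V_m` of the polygon `conv T` in positive order, extended
`(m+1)`-periodically.** [cite: KishimotoYoneda2022, §3 proof of Prop. 3.1 (ii) ("`n₀, n₁, …, n_{p-1}` … in this order")] -/
def V (P : PolyCfg T e) (j : ℕ) : Fin 3 → ℝ := chain (lift T e) e P.p₀ j - hc e • e

/-- Polygon bookkeeping: `two_le_m`. [folklore] -/
theorem two_le_m : 2 ≤ P.m := P.faceCfg.two_le_nverts

/-- Polygon bookkeeping: `V_periodic`. [folklore] -/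
theorem V_periodic (j : ℕ) : P.V (j + (P.m + 1)) = P.V j := by
  unfold V m; rw [chain_periodic]

/-- Linearity rule `V_add_lift`. [folklore] -/
theorem V_add_lift (j : ℕ) : P.V j + hc e • e = chain (lift T e) e P.p₀ j := by
  unfold V; simp

/-- Polygon bookkeeping: `V_zero`. [folklore] -/
theorem V_zero : P.V 0 = P.far := by
  unfold V; rw [chain_of_le (Nat.zero_le _), FaceCfg.poly_zero]; unfold p₀; simp

/-- Vertices belong to `T`. [folklore] -/
theorem V_mem (j : ℕ) : P.V j ∈ T := by
  obtain ⟨j', hj', e1, -⟩ := chain_consecutive (S := lift T e) (φ := e) (p₀ := P.p₀) j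
  unfold V
  rw [e1, ← mem_lift]
  exact (Finset.mem_filter.1 (P.faceCfg.poly_mem_face' (Nat.le_succ_of_le hj')).1).1

/-- Polygon bookkeeping: `V_plane`. [folklore] -/
theorem V_plane (j : ℕ) : e ⬝ᵥ P.V j = 0 := P.plane _ (P.V_mem j)

/-- The edge inequality: all of `T` lies on one side of each side `[V_j, V_{j+1}]`, with equality
exactly on the segment. [cite: KishimotoYoneda2022, §3 proof of Prop. 3.1 (i)(a) (the sides `E` of `S^{conv}_∥`)] -/
theorem edge (j : ℕ) {s : Fin 3 → ℝ} (hs : s ∈ T) :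
    0 ≤ pc e (P.V (j + 1) - P.V j) (s - P.V j) ∧
      (pc e (P.V (j + 1) - P.V j) (s - P.V j) = 0 →
        ∃ θ : ℝ, 0 ≤ θ ∧ θ ≤ 1 ∧ s = P.V j + θ • (P.V (j + 1) - P.V j)) := by
  obtain ⟨j', hj', e1, e2⟩ := chain_consecutive (S := lift T e) (φ := e) (p₀ := P.p₀) j
  have hsL : s + hc e • e ∈ face (lift T e) e 1 :=
    Finset.mem_filter.2 ⟨add_mem_lift.2 hs, P.lift_level (add_mem_lift.2 hs)⟩
  obtain ⟨h1, h2⟩ := P.faceCfg.edge hj' hsL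
  rw [← e1, ← e2, ← P.V_add_lift, ← P.V_add_lift,
    P.lift_triple (P.V_plane j) (P.V_plane (j + 1)) (P.plane s hs)] at h1 h2
  have hcpos := P.hc_pos
  refine ⟨(mul_nonneg_iff_of_pos_left hcpos).1 h1, fun h0 => ?_⟩
  obtain ⟨θ, hθ0, hθ1, hθ⟩ := h2 (by rw [h0, mul_zero])
  refine ⟨θ, hθ0, hθ1, ?_⟩
  have h' : s = (P.V j + hc e • e + θ • (P.V (j + 1) + hc e • e - (P.V j + hc e • e))) - hc e • e := by
    rw [← hθ, add_sub_cancel_right]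
  rw [h']; abel

/-- Consecutive vertices are distinct. [folklore] -/
theorem V_ne_succ (j : ℕ) : P.V j ≠ P.V (j + 1) := by
  obtain ⟨j', hj', e1, e2⟩ := chain_consecutive (S := lift T e) (φ := e) (p₀ := P.p₀) j
  intro h
  apply P.faceCfg.poly_ne_succ hj'
  rw [← e1, ← e2, ← P.V_add_lift, ← P.V_add_lift, h]

/-- **Positive orientation**: `τ_j = τ(V_j, V_{j+1}) > 0`. [folklore] -/
theorem tau_pos (j : ℕ) : 0 < pc e (P.V j) (P.V (j + 1)) := by
  -- evaluate the edge inequality at `-V_j ∈ T`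
  have hneg : -P.V j ∈ T := P.symm _ (P.V_mem j)
  have h := (P.edge j hneg).1
  have hval : pc e (P.V (j + 1) - P.V j) (-P.V j - P.V j) = 2 * pc e (P.V j) (P.V (j + 1)) := by
    rw [show -P.V j - P.V j = (-2 : ℝ) • P.V j by ext i; simp; ring,
      pc_smul_right, pc_sub_left, pc_self, sub_zero, pc_anticomm]; ring
  rw [hval] at h
  rcases (show 0 ≤ pc e (P.V j) (P.V (j + 1)) by linarith).lt_or_eq with hlt | heq
  · exact hlt
  · exfalso
    -- `V_{j+1} ∥ V_j`, and then all of `T` is parallel to `V_j`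
    have hVj0 : P.V j ≠ 0 := fun h0 => P.zero_notMem (h0 ▸ P.V_mem j)
    have hpar : P.V j ⨯₃ P.V (j + 1) = 0 := by
      rw [cross_planar P.he (P.V_plane j) (P.V_plane (j + 1)), ← heq, zero_div, zero_smul]
    have hV1 := eq_smul_of_cross_eq_zero hVj0 (u := P.V (j + 1)) (by rw [← cross_anticomm, hpar, neg_zero])
    set r := (P.V j ⬝ᵥ P.V (j + 1)) / (P.V j ⬝ᵥ P.V j) with hr
    have hr1 : r ≠ 1 := by
      intro h1; apply P.V_ne_succ j; rw [hV1, h1, one_smul]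
    have hall : ∀ s ∈ T, pc e (P.V j) s = 0 := by
      intro s hs
      have h1 := (P.edge j hs).1
      have h2 := (P.edge j (P.symm s hs)).1
      rw [hV1, show r • P.V j - P.V j = (r - 1) • P.V j by rw [sub_smul, one_smul], pc_smul_left,
        pc_sub_right, pc_self, sub_zero] at h1 h2
      rw [pc_neg_right] at h2
      rcases lt_or_gt_of_ne (sub_ne_zero.2 hr1) with hlt | hlt
      · nlinarith
      · nlinarith
    obtain ⟨a, ha, b, hb, hab⟩ := P.span
    have ha0 := hall a ha
    have hb0 := hall b hb
    -- `a ∥ V_j` and `b ∥ V_j`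
    have hca : P.V j ⨯₃ a = 0 := by
      rw [cross_planar P.he (P.V_plane j) (P.plane a ha), ha0, zero_div, zero_smul]
    have hcb : P.V j ⨯₃ b = 0 := by
      rw [cross_planar P.he (P.V_plane j) (P.plane b hb), hb0, zero_div, zero_smul]
    have ea := eq_smul_of_cross_eq_zero hVj0 (u := a) (by rw [← cross_anticomm, hca, neg_zero])
    have eb := eq_smul_of_cross_eq_zero hVj0 (u := b) (by rw [← cross_anticomm, hcb, neg_zero])
    apply hab
    rw [ea, eb, pc_smul_left, pc_smul_right, pc_self, mul_zero, mul_zero]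

/-! ### Edge functionals and sectors -/

/-- The edge functional `f_j` of the side `[V_j, V_{j+1}]`: linear, `= 1` on the side, `≤ 1` on `T`.
[cite: KishimotoYoneda2022, §3 proof of Prop. 3.1 (i)(a) ("the linear functional `f` on `P` such that `f ≡ 1` on `E`")] -/
def fE (P : PolyCfg T e) (j : ℕ) (x : Fin 3 → ℝ) : ℝ :=
  pc e x (P.V (j + 1) - P.V j) / pc e (P.V j) (P.V (j + 1))

/-- Edge-functional / gauge bookkeeping: `fE_V_self`. [folklore] -/
theorem fE_V_self (j : ℕ) : P.fE j (P.V j) = 1 := by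
  unfold fE; rw [pc_sub_right, pc_self, sub_zero, div_self (P.tau_pos j).ne']

/-- Edge-functional / gauge bookkeeping: `fE_V_succ`. [folklore] -/
theorem fE_V_succ (j : ℕ) : P.fE j (P.V (j + 1)) = 1 := by
  unfold fE; rw [pc_sub_right, pc_self, zero_sub, pc_anticomm, neg_neg, div_self (P.tau_pos j).ne']

/-- Linearity rule `fE_add`. [folklore] -/
theorem fE_add (j : ℕ) (x y : Fin 3 → ℝ) : P.fE j (x + y) = P.fE j x + P.fE j y := by
  unfold fE; rw [pc_add_left, add_div]

/-- Linearity rule `fE_smul`. [folklore] -/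
theorem fE_smul (j : ℕ) (r : ℝ) (x : Fin 3 → ℝ) : P.fE j (r • x) = r * P.fE j x := by
  unfold fE; rw [pc_smul_left, mul_div_assoc]

/-- Linearity rule `fE_neg`. [folklore] -/
theorem fE_neg (j : ℕ) (x : Fin 3 → ℝ) : P.fE j (-x) = -P.fE j x := by
  rw [show -x = (-1 : ℝ) • x by simp, fE_smul]; ring

/-- Linearity rule `fE_sub`. [folklore] -/
theorem fE_sub (j : ℕ) (x y : Fin 3 → ℝ) : P.fE j (x - y) = P.fE j x - P.fE j y := by
  rw [sub_eq_add_neg, fE_add, fE_neg, ← sub_eq_add_neg]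

/-- Simp bookkeeping: `fE_zero`. [folklore] -/
@[simp] theorem fE_zero (j : ℕ) : P.fE j 0 = 0 := by unfold fE; rw [show (0 : Fin 3 → ℝ) = (0:ℝ) • P.V j by simp, pc_smul_left]; simp

/-- Linearity rule `fE_sum`. [folklore] -/
theorem fE_sum {ι : Type*} (j : ℕ) (s : Finset ι) (g : ι → Fin 3 → ℝ) :
    P.fE j (∑ i ∈ s, g i) = ∑ i ∈ s, P.fE j (g i) := by
  induction s using Finset.induction_on with
  | empty => simp
  | insert a s ha ih => rw [Finset.sum_insert ha, Finset.sum_insert ha, fE_add, ih]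

/-- The edge functional as a dot product with a fixed vector. [folklore] -/
theorem fE_eq_dot (j : ℕ) (x : Fin 3 → ℝ) :
    P.fE j x = ((pc e (P.V j) (P.V (j + 1)))⁻¹ • ((P.V (j + 1) - P.V j) ⨯₃ e)) ⬝ᵥ x := by
  unfold fE pc
  rw [smul_dotProduct, smul_eq_mul, div_eq_inv_mul]
  congr 1
  simp [cross_apply, dotProduct, Fin.sum_univ_three]; ring

/-- `1 - f_j(s) = (edge quantity)/τ_j`. [folklore] -/
theorem one_sub_fE (j : ℕ) (s : Fin 3 → ℝ) :
    1 - P.fE j s = pc e (P.V (j + 1) - P.V j) (s - P.V j) / pc e (P.V j) (P.V (j + 1)) := by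
  have hτ := (P.tau_pos j).ne'
  unfold fE
  field_simp
  rw [pc_sub_left, pc_sub_right, pc_sub_right, pc_sub_right, pc_self, pc_anticomm e s (P.V (j+1)),
    pc_anticomm e s (P.V j), pc_anticomm e (P.V (j + 1)) (P.V j)]
  ring

/-- **`f_j ≤ 1` on `T`.** [cite: KishimotoYoneda2022, §3 proof of Prop. 3.1 (i)(a) ("`f ≤ 1` on `S^{conv}_∥`")] -/
theorem fE_le_one (j : ℕ) {s : Fin 3 → ℝ} (hs : s ∈ T) : P.fE j s ≤ 1 := by
  have h := (P.edge j hs).1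
  have h1 := P.one_sub_fE j s
  have : 0 ≤ 1 - P.fE j s := by rw [h1]; exact div_nonneg h (P.tau_pos j).le
  linarith

/-- **`f_j(s) = 1` on `T` only on the side.** [cite: KishimotoYoneda2022, §3 proof of Prop. 3.1 (i)(a) ("`f(n) = 1` imply `n ∈ E`")] -/
theorem fE_eq_one (j : ℕ) {s : Fin 3 → ℝ} (hs : s ∈ T) (h1 : P.fE j s = 1) :
    ∃ θ : ℝ, 0 ≤ θ ∧ θ ≤ 1 ∧ s = P.V j + θ • (P.V (j + 1) - P.V j) := by
  apply (P.edge j hs).2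
  have h := P.one_sub_fE j s
  rw [h1, sub_self] at h
  have := (div_eq_zero_iff.1 h.symm)
  exact this.resolve_right (P.tau_pos j).ne'

/-- `-f_j ≤ 1` on `T` as well (symmetry), so `|f_j| ≤ 1` on `T`. [folklore] -/
theorem neg_one_le_fE (j : ℕ) {s : Fin 3 → ℝ} (hs : s ∈ T) : -1 ≤ P.fE j s := by
  have := P.fE_le_one j (P.symm s hs)
  rw [fE_neg] at this; linarith

/-- **`2D` Cramer in the plane**: `τ(b, c) x = τ(x, c) b + τ(b, x) c` for planar `x, b, c`. [folklore] -/
theorem cramer_planar {x b c : Fin 3 → ℝ} (hx : e ⬝ᵥ x = 0) (hb : e ⬝ᵥ b = 0) (hc' : e ⬝ᵥ c = 0) :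
    pc e b c • x = pc e x c • b + pc e b x • c := by
  have h := cramer_triple e b c x
  have h0 : x ⬝ᵥ (b ⨯₃ c) = 0 := by
    rw [cross_planar P.he hb hc', dotProduct_smul, smul_eq_mul, dotProduct_comm x e, hx, mul_zero]
  rw [h0, zero_smul, zero_add] at h
  exact h

/-- Values of the edge functionals on a sector combination. [folklore] -/
theorem fE_combo (i j : ℕ) (s t : ℝ) :
    P.fE i (s • P.V j + t • P.V (j + 1)) = s * P.fE i (P.V j) + t * P.fE i (P.V (j + 1)) := by
  rw [fE_add, fE_smul, fE_smul]

/-- On the sector `j`, `f_j(s V_j + t V_{j+1}) = s + t`. [cite: KishimotoYoneda2022, §3 ("`N ≡ f` on the sectorial region")] -/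
theorem fE_sector_self (j : ℕ) (s t : ℝ) : P.fE j (s • P.V j + t • P.V (j + 1)) = s + t := by
  rw [fE_combo, fE_V_self, fE_V_succ, mul_one, mul_one]

/-- On the sector `j`, every `f_i ≤ f_j` (non-negative coefficients). [cite: KishimotoYoneda2022, §3 ("`N ≡ f` on the sectorial region")] -/
theorem fE_sector_le (i j : ℕ) {s t : ℝ} (hs : 0 ≤ s) (ht : 0 ≤ t) :
    P.fE i (s • P.V j + t • P.V (j + 1)) ≤ s + t := by
  rw [fE_combo]
  have h1 := mul_le_mul_of_nonneg_left (P.fE_le_one i (P.V_mem j)) hs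
  have h2 := mul_le_mul_of_nonneg_left (P.fE_le_one i (P.V_mem (j + 1))) ht
  linarith

end PolyCfg

end KY

end Literature.Analysis.FluidPDE
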